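import Summits.BirchSwinnertonDyer.BirchSwinnertonDyer.Theorems.LeadingTermPinchPrimeAnalyticRankOfRankLeOne
import Summits.BirchSwinnertonDyer.BirchSwinnertonDyer.Theorems.LeadingTermLBOfCruxes

/-!
# BirchSwinnertonDyer / LeadingTerm — crux `PinchPrime` (stmt-BirchSwinnertonDyer-16218):
# SUMMIT-STRENGTH CERTIFICATE (crux-strategist REDIRECT r1, 2026-08-17)

Kernel-checked record, for the tribunal, of WHICH NAMED OPEN FRAGMENTS OF THE SUMMIT the crux
`LeadingTerm.PinchPrime` already contains — each modulo PUBLISHED theorems entering as named-fact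
hypotheses only (Perrin-Riou's `p`-adic Gross–Zagier formula, Gross–Zagier, `K`-rationality of
Heegner points, modularity, Hoffstein–Luo, Carayol), never modulo a conjecture:

* `RankOneConverse`      — `rank = 1 ⇒ r_an = 1` with NO Selmer / `Ш` hypothesis
                            (landed G16, `stub_analyticRank_eq_one_of_rank_eq_one_of_pinchPrime`);
* `RankZeroConverse`     — `rank = 0 ⇒ r_an = 0` (landed, refuter:
                            `analyticRank_eq_zero_of_rank_eq_zero_of_pinchPrime`);
* `MordellWeilParity`    — `rank ≡ r_an (mod 2)` (landed, `mordellWeilParity_of_pinchPrime`);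
* `PosRankOfSignMinusOne`— every `E/ℚ` with root number `-1` has a point of infinite order
                            (NEW here: `odd_rank_of_rootNumber_eq_neg_one`), in particular every
                            `n ≡ 5, 6, 7 (mod 8)` would be a congruent number;
* `TwoPointsOnAnalyticRankTwo` (= LB₂) — every `E/ℚ` with `ord_{s=1} L(E,s) ≥ 2` has TWO
                            independent rational points (NEW here:
                            `two_le_rank_of_two_le_analyticRank`), and THREE when `ord` is odd `≥ 3`
                            (`three_le_rank_of_odd`); summarised as `min 2 r_an ≤ rank`
                            (`min_two_analyticRank_le_rank`).

Each fragment is a literal consequence of the summit `BirchSwinnertonDyer` (`…_of_summit` below,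
pure logic), open in print, and sits on a catalogued barrier:
`Literature.Barriers.BirchSwinnertonDyer.HeegnerPointBarrier` (no supply of points in analytic rank
`≥ 2`: LB₂), `Literature.Barriers.BirchSwinnertonDyer.SelmerRankBarrier` (rank-0 / rank-1 converses
without a Selmer hypothesis: no known argument separates `E(ℚ)` from `Ш` inside `Sel_{p^∞}`), and
the parity literature (Dokchitser–Dokchitser 2010: MW-parity is known only from finiteness of
`Ш[p^∞]` for one `p`). So — second opinion confirming strategist s2 — the crux, although it does NOT
cheaply give `S` (it lacks the upper bound `rank ≤ r_an` on `{rank ≥ 2}`; BC2 probes fail), carries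
the LOWER-BOUND half of BSD-rank up to two points plus both low-rank converses: summit-class content
with no engine in print. Companion: `Cruxes/PinchPrime/STRATEGY-CENSUS.md` (r1 section).

No `sorry`. Hypotheses named `hPR hGZ hHeeg hmod hHL hlev` are exactly those of the landed G16 file.
-/

noncomputable section

set_option linter.dupNamespace false

namespace Summit.BirchSwinnertonDyer.BirchSwinnertonDyer.Cruxes.PinchPrime.SummitStrength

open scoped MatrixGroups ModularForm
open CongruenceSubgroup NumberField Literature.NumberTheory.EllipticCurves
  Literature.NumberTheory.EllipticCurves.ModularForms Literature.Barriers.BirchSwinnertonDyer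
open Summit.BirchSwinnertonDyer.BirchSwinnertonDyer.Theses
open Summit.BirchSwinnertonDyer.BirchSwinnertonDyer.Theorems.PinchPrime.Negative
open Summit.BirchSwinnertonDyer.BirchSwinnertonDyer.Cruxes.PinchPrime.FirstLayerStability

/-! ## The named fragments of the summit -/

/-- Fragment: the rank-one converse with no Selmer hypothesis. [folklore] -/
def RankOneConverse : Prop :=
  ∀ (W : WeierstrassCurve ℚ) [W.IsElliptic] [W.IsGloballyMinimal],
    W.mordellWeilRank = 1 → W.analyticRank = 1

/-- Fragment: the rank-zero converse (`E(ℚ)` finite ⇒ `L(E,1) ≠ 0`). [folklore] -/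
def RankZeroConverse : Prop :=
  ∀ (W : WeierstrassCurve ℚ) [W.IsElliptic] [W.IsGloballyMinimal],
    W.mordellWeilRank = 0 → W.analyticRank = 0

/-- Fragment: the Mordell–Weil parity conjecture. [folklore] -/
def MordellWeilParity : Prop :=
  ∀ (W : WeierstrassCurve ℚ) [W.IsElliptic] [W.IsGloballyMinimal],
    Even W.mordellWeilRank ↔ Even W.analyticRank

/-- Fragment: root number `-1` forces a rational point of infinite order. [folklore] -/
def PosRankOfSignMinusOne : Prop :=
  ∀ (W : WeierstrassCurve ℚ) [W.IsElliptic] [W.IsGloballyMinimal],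
    W.rootNumber = -1 → 1 ≤ W.mordellWeilRank

/-- Fragment LB₂: two independent points on every curve of analytic rank `≥ 2`. [folklore] -/
def TwoPointsOnAnalyticRankTwo : Prop :=
  ∀ (W : WeierstrassCurve ℚ) [W.IsElliptic] [W.IsGloballyMinimal],
    2 ≤ W.analyticRank → 2 ≤ W.mordellWeilRank

/-! ## Each fragment is a piece of the summit (pure logic) -/

/-- The summit gives the rank-one converse (pure logic). [folklore] -/
theorem rankOneConverse_of_summit (h : _root_.BirchSwinnertonDyer) : RankOneConverse := by
  intro W hW _ h1
  have := h W hW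
  omega

/-- The summit gives the rank-zero converse (pure logic). [folklore] -/
theorem rankZeroConverse_of_summit (h : _root_.BirchSwinnertonDyer) : RankZeroConverse := by
  intro W hW _ h0
  have := h W hW
  omega

/-- The summit gives Mordell–Weil parity (pure logic). [folklore] -/
theorem mordellWeilParity_of_summit (h : _root_.BirchSwinnertonDyer) : MordellWeilParity := by
  intro W hW _
  rw [h W hW]

/-- The summit gives LB₂ (pure logic). [folklore] -/
theorem twoPoints_of_summit (h : _root_.BirchSwinnertonDyer) : TwoPointsOnAnalyticRankTwo := by
  intro W hW _ h2
  have := h W hW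
  omega

/-! ## The crux contains each fragment -/

section Consequences

variable (hS : LeadingTerm.PinchPrime)
include hS

/-- **Root number `-1` ⇒ odd Mordell–Weil rank**, from the crux and Carayol: modularity is a
conjunct of the crux (`modularity_of_pinchPrime`), Carayol puts the newform at level `N_W`, Hecke's
functional equation gives `Even r_an ↔ w = 1` (`even_analyticRank_iff_of_isNewformOf_conductorLevel`),
and the crux's parity window (`mordellWeilParity_of_pinchPrime`) transports oddness to the rank.
[cite: DiamondShurman2005, Thm. 8.8.1] [cite: SilvermanAEC2009, C.16 p. 451 (after Thm. 16.3)] -/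
theorem odd_rank_of_rootNumber_eq_neg_one
    (hlev : ∀ {N : ℕ} [NeZero N], IsNewformOf.level_eq_conductorNorm (N := N))
    (W : WeierstrassCurve ℚ) [W.IsElliptic] [W.IsGloballyMinimal] (hw : W.rootNumber = -1) :
    Odd W.mordellWeilRank := by
  obtain ⟨N, hN, f, hf⟩ := modularity_of_pinchPrime hS W
  obtain rfl : N = W.conductorNorm ℤ := hlev hf
  have hodd : Odd W.analyticRank := by
    rw [← Nat.not_even_iff_odd]
    intro heven
    have h1 : W.rootNumber = 1 :=
      (even_analyticRank_iff_of_isNewformOf_conductorLevel hf).mp heven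
    rw [hw] at h1
    norm_num at h1
  rw [← Nat.not_even_iff_odd, mordellWeilParity_of_pinchPrime hS hlev W, Nat.not_even_iff_odd]
  exact hodd

/-- **The crux ⇒ `PosRankOfSignMinusOne`** (below Carayol). In particular, granting the crux, every
square-free `n ≡ 5, 6, 7 (mod 8)` is a congruent number (root number of `y² = x³ - n²x` is `-1`).
[cite: DiamondShurman2005, Thm. 8.8.1] -/
theorem posRankOfSignMinusOne_of_pinchPrime
    (hlev : ∀ {N : ℕ} [NeZero N], IsNewformOf.level_eq_conductorNorm (N := N)) :
    PosRankOfSignMinusOne := by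
  intro W _ _ hw
  exact (odd_rank_of_rootNumber_eq_neg_one hS hlev W hw).pos

/-- **The crux ⇒ `MordellWeilParity`** (landed, restated by name). [cite: DiamondShurman2005, Thm. 8.8.1] -/
theorem mordellWeilParity_of_pinchPrime'
    (hlev : ∀ {N : ℕ} [NeZero N], IsNewformOf.level_eq_conductorNorm (N := N)) :
    MordellWeilParity :=
  fun W _ _ ↦ mordellWeilParity_of_pinchPrime hS hlev W

/-- **The crux ⇒ `RankZeroConverse`** (landed, restated by name).
[cite: MazurTateTeitelbaum1986Invent, §I.14 (14.3) and §II.10] -/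
theorem rankZeroConverse_of_pinchPrime : RankZeroConverse :=
  fun W _ _ h0 ↦ analyticRank_eq_zero_of_rank_eq_zero_of_pinchPrime hS W h0

/-- **Analytic rank `1` forces a point** from the crux alone (no Gross–Zagier–Kolyvagin): `rank = 0`
would give `r_an = 0` by the level-zero window. [cite: MazurTateTeitelbaum1986Invent, §I.14 (14.3) and §II.10] -/
theorem one_le_rank_of_analyticRank_eq_one (W : WeierstrassCurve ℚ) [W.IsElliptic]
    [W.IsGloballyMinimal] (h1 : W.analyticRank = 1) : 1 ≤ W.mordellWeilRank := by
  by_contra hlt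
  have h0 : W.mordellWeilRank = 0 := by omega
  have := analyticRank_eq_zero_of_rank_eq_zero_of_pinchPrime hS W h0
  omega

end Consequences

section G16Facts

variable (hPR : perrinRiou_padicGrossZagier)
  (hGZ : ∀ (N : ℕ) [NeZero N] (W : WeierstrassCurve ℚ) (K : Type) [Field K] [NumberField K],
    gross_zagier N W K)
  (hHeeg : ∀ (W : WeierstrassCurve ℚ) (K : Type) [Field K] [NumberField K],
    exists_isHeegnerPoint W K)
  (hmod : exists_isNewformOf) (hHL : HoffsteinLuo1997_exists_twist_L_one_ne_zero)
  (hlev : ∀ {N : ℕ} [NeZero N], IsNewformOf.level_eq_conductorNorm (N := N))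
  (hS : LeadingTerm.PinchPrime)
include hPR hGZ hHeeg hmod hHL hlev hS

/-- **The crux ⇒ `RankOneConverse`** (landed G16, restated by name). [cite: PerrinRiou1987, Thm. 1.3 and §1.4] -/
theorem rankOneConverse_of_pinchPrime : RankOneConverse :=
  fun W _ _ h1 ↦
    stub_analyticRank_eq_one_of_rank_eq_one_of_pinchPrime hPR hGZ hHeeg hmod hHL hlev hS W h1

/-- **LB₂ from the crux: two independent points on every curve of analytic rank `≥ 2`.** If
`rank ≤ 1` the two converses give `r_an = rank ≤ 1`. This is the statement behind
`Literature.Barriers.BirchSwinnertonDyer.HeegnerPointBarrier`: no construction of a second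
independent point is known for a single family, let alone every `E/ℚ`.
[cite: PerrinRiou1987, Thm. 1.3 and §1.4] [cite: GrossZagierInvent1986, Thm. I.6.3 and V.§2] -/
theorem two_le_rank_of_two_le_analyticRank (W : WeierstrassCurve ℚ) [W.IsElliptic]
    [W.IsGloballyMinimal] (h2 : 2 ≤ W.analyticRank) : 2 ≤ W.mordellWeilRank := by
  by_contra hlt
  have hle : W.mordellWeilRank ≤ 1 := by omega
  have := analyticRank_eq_rank_of_rank_le_one_of_pinchPrime hPR hGZ hHeeg hmod hHL hlev hS W hle
  omega

/-- **The crux ⇒ `TwoPointsOnAnalyticRankTwo`** (LB₂, by name). [cite: PerrinRiou1987, Thm. 1.3 and §1.4] -/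
theorem twoPoints_of_pinchPrime : TwoPointsOnAnalyticRankTwo :=
  fun W _ _ h2 ↦ two_le_rank_of_two_le_analyticRank hPR hGZ hHeeg hmod hHL hlev hS W h2

/-- **`min 2 r_an ≤ rank` for every curve**, from the crux (no Gross–Zagier–Kolyvagin needed: the
rank-`1` lower bound comes from the level-zero window, the rank-`2` one from LB₂).
[cite: PerrinRiou1987, Thm. 1.3 and §1.4] [cite: MazurTateTeitelbaum1986Invent, §I.14 (14.3) and §II.10] -/
theorem min_two_analyticRank_le_rank (W : WeierstrassCurve ℚ) [W.IsElliptic]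
    [W.IsGloballyMinimal] : min 2 W.analyticRank ≤ W.mordellWeilRank := by
  rcases Nat.lt_or_ge W.analyticRank 2 with h | h
  · rcases Nat.lt_or_ge W.analyticRank 1 with h0 | h1
    · have : W.analyticRank = 0 := by omega
      rw [this]; simp
    · have h1' : W.analyticRank = 1 := by omega
      rw [h1']
      exact le_trans (by norm_num) (one_le_rank_of_analyticRank_eq_one hS W h1')
  · rw [min_eq_left h]
    exact two_le_rank_of_two_le_analyticRank hPR hGZ hHeeg hmod hHL hlev hS W h

/-- **Three independent points on every curve of odd analytic rank `≥ 3`**, from LB₂ and the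
crux's parity window. (For even `r_an ≥ 4` the crux gives only `rank ≥ 2`, even: `ord_T L_p` is
even and `≥ 2`, nothing in print excludes `2`.) [cite: GreenbergLNM1716, §5 (p. 181)] -/
theorem three_le_rank_of_odd (W : WeierstrassCurve ℚ) [W.IsElliptic] [W.IsGloballyMinimal]
    (hodd : Odd W.analyticRank) (h3 : 3 ≤ W.analyticRank) : 3 ≤ W.mordellWeilRank := by
  have h2 := two_le_rank_of_two_le_analyticRank hPR hGZ hHeeg hmod hHL hlev hS W (by omega)
  have hro : Odd W.mordellWeilRank := by
    rw [← Nat.not_even_iff_odd, mordellWeilParity_of_pinchPrime hS hlev W, Nat.not_even_iff_odd]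
    exact hodd
  obtain ⟨k, hk⟩ := hro
  omega

/-- **SUMMIT-STRENGTH CERTIFICATE (bundle).** Below the six published theorems of G16 as named
facts, the crux `LeadingTerm.PinchPrime` implies, for every globally minimal elliptic `W/ℚ`: the
two low-rank converses, Mordell–Weil parity, positive rank at sign `-1`, and the lower bound
`min 2 r_an ≤ rank` — i.e. BSD-rank on `{rank ≤ 1} ∪ {r_an ≤ 1}` and two points on `{r_an ≥ 2}`.
What it does NOT give is the upper bound `rank ≤ r_an` on `{rank ≥ 2}` (route item `SqueezeUBR2`).
[cite: PerrinRiou1987, Thm. 1.3 and §1.4] [cite: DiamondShurman2005, Thm. 8.8.1] -/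
theorem summitFragments_of_pinchPrime :
    RankZeroConverse ∧ RankOneConverse ∧ MordellWeilParity ∧ PosRankOfSignMinusOne ∧
      TwoPointsOnAnalyticRankTwo :=
  ⟨rankZeroConverse_of_pinchPrime hS, rankOneConverse_of_pinchPrime hPR hGZ hHeeg hmod hHL hlev hS,
    mordellWeilParity_of_pinchPrime' hS hlev, posRankOfSignMinusOne_of_pinchPrime hS hlev,
    twoPoints_of_pinchPrime hPR hGZ hHeeg hmod hHL hlev hS⟩

/-- **What is left of the summit after the crux**: granting the crux, the six facts of G16 and
Gross–Zagier–Kolyvagin (`rank_eq_analyticRank_of_analyticRank_le_one`, a published theorem as named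
fact), the summit `BirchSwinnertonDyer` is EQUIVALENT to BSD-rank on the doubly higher stratum
`{rank ≥ 2 ∧ r_an ≥ 2}` of globally minimal curves — the crux has absorbed both low-rank converses,
and on that stratum it still contributes `2 ≤ rank` and parity but neither `rank ≤ r_an` (route item
`SqueezeUBR2`) nor `r_an ≤ rank` beyond two points. Reduction to a global minimal model by
`hasGlobalMinimalModel_rat_holds` and the invariance lemmas `leadingTerm_mordellWeilRank_smul`,
`leadingTerm_entireLFunction_smul`. [folklore] -/
theorem summit_iff_doublyHigher_of_pinchPrime (hGZK : rank_eq_analyticRank_of_analyticRank_le_one) :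
    _root_.BirchSwinnertonDyer ↔
      ∀ (W : WeierstrassCurve ℚ) [W.IsElliptic] [W.IsGloballyMinimal],
        2 ≤ W.mordellWeilRank → 2 ≤ W.analyticRank → W.analyticRank = W.mordellWeilRank := by
  constructor
  · intro h W hW _ _ _
    exact h W hW
  · intro hres W hW
    haveI : W.IsElliptic := hW
    obtain ⟨C, hCmin⟩ := WeierstrassCurve.hasGlobalMinimalModel_rat_holds W
    haveI : (C • W).IsGloballyMinimal := hCmin
    have hMW : (C • W).mordellWeilRank = W.mordellWeilRank :=
      Theorems.leadingTerm_mordellWeilRank_smul W C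
    have hAN : (C • W).analyticRank = W.analyticRank := by
      simp only [WeierstrassCurve.analyticRank, Theorems.leadingTerm_entireLFunction_smul W C]
    rw [← hMW, ← hAN]
    rcases Nat.lt_or_ge (C • W).mordellWeilRank 2 with hlt | hge
    · exact analyticRank_eq_rank_of_rank_le_one_of_pinchPrime hPR hGZ hHeeg hmod hHL hlev hS (C • W)
        (by omega)
    · rcases Nat.lt_or_ge (C • W).analyticRank 2 with hlt' | hge'
      · exact ((hGZK (C • W) (by omega)).1).symm
      · exact hres (C • W) hge hge'

end G16Facts

end Summit.BirchSwinnertonDyer.BirchSwinnertonDyer.Cruxes.PinchPrime.SummitStrength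

end
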